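import Summits.CriticalPhenomena.CardyFormulaZ2.Theorems.CardyBondTriangularBondTriangularCardyStubCorner
import Summits.CriticalPhenomena.CardyFormulaZ2.Theorems.CardyBondTriangularBondTriangularCardyKiteDuality
import HarnessLib

/-!
# Route CardyBondTriangular · crux `BondTriangularCardy` (stmt-CriticalPhenomena-4664), line `birth`:
# Stub `stub_clDuality` — the Chayes–Lei duality lemma

Crux `Summit.CriticalPhenomena.CardyFormulaZ2.Theses.CardyBondTriangular.BondTriangularCardy`, line
`birth`, stub `stub_clDuality : Sig.stub_clDuality` (the registered signature; its text
`Sig.stub_clDuality` is owned by the landed file `…BondTriangularCardyStubCorner` of this namespace,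
imported): in every 4-marked discrete domain `G` of `𝕋`, every configuration `σ` of the Chayes–Lei
hexagon model (Rev. Math. Phys. 19 (2007) §2.1: pure yellow / pure blue / three admissible split
hexagons, two hexagons connected when they share a yellow edge or half-edge) has EITHER a yellow
crossing — a `𝕋`-walk of hexagons of `G`, none pure blue, consecutive ones `clYellowGraph`-adjacent,
from the tail of a dart of the stretch `0` to the tail of a dart of the stretch `2`, showing yellow
towards both darts — OR, dually, a blue crossing from the stretch `1` to the stretch `3`. This is
the existence half of Bollobás–Riordan's Lemma 5 (*Percolation* (2006), Ch. 7, p. 169) for the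
hexagon model with half-edge connectivity.

Proof: the kite-interface toolkit of this line (`…BondTriangularCardyKiteDarts`, `…KiteColour`,
`…KiteDomain`, `…KiteInvariant`, `…KiteDuality`, sub-namespace `…BondTriangularCardyLine.Kite`):
Bollobás–Riordan's interface-following argument (pp. 169–171, Fig. 9) run on the tiling of each
hexagon by six kites, one per corner, coloured by the corner colours of its state (outside the
domain: per boundary dart, yellow beyond the stretches `0, 2`, blue beyond `1, 3`). At every vertex
of the kite tiling the kites of each colour are consecutive (Chayes–Lei's "only three of the six
possible split hexagons occur": a hexagon yellow at an up-corner is yellow at the neighbouring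
down-corners), so the oriented interface started at the corner of the first marked site is a
simple path (`Kite.succ_injective`), ending at another marked corner, and the kites on its two
sides carry a yellow chain from the stretch `0` and a blue chain to the stretch `3`
(`Kite.inv_succ`); the end mark decides which crossing exists (`Kite.yCross_or_bCross`).

References: B. Bollobás, O. Riordan, *Percolation*, CUP 2006, Ch. 7 Lemma 5 pp. 169–171, Fig. 9
[BollobasRiordan2006]; L. Chayes, H. K. Lei, Rev. Math. Phys. 19 (2007) §2.1–2.3 [ChayesLei2007].
-/

namespace Summit.CriticalPhenomena.CardyFormulaZ2.Theorems.BondTriangularCardyLine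

/-- **Stub `stub_clDuality` of the line `birth` (the Chayes–Lei duality lemma)**: in a 4-marked
discrete domain, every configuration of the Chayes–Lei hexagon model has a yellow stretch-`0` →
stretch-`2` crossing or a blue stretch-`1` → stretch-`3` crossing — the two sets `Kite.yCross G`,
`Kite.bCross G` of the toolkit are literally the two disjuncts. (ref: BollobasRiordan2006, Ch. 7
Lemma 5 p. 169; ChayesLei2007 §2.1) -/
theorem stub_clDuality : Sig.stub_clDuality := by
  intro G σ
  rcases Kite.yCross_or_bCross G σ with h | h
  · exact Or.inl h
  · exact Or.inr h

end Summit.CriticalPhenomena.CardyFormulaZ2.Theorems.BondTriangularCardyLine
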